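import Mathlib
import HarnessLib
import Summits.Ventures.LatticeQCDFlow.Exactness.MetropolisSweepInstances
import Summits.Ventures.LatticeQCDFlow.Exactness.SUNMetropolisKickLaw
import Summits.Ventures.LatticeQCDFlow.Exactness.SUNMultiStepPositionLaw

/-!
# The engine's kick laws dominate Haar measure near the identity: `U(1)` box kick, `SU(2)` Pauli kick, `SU(N)` exponential kick, and the HMC chart kick

HONEST FRAMING: exact (Metropolis-corrected) sampling algorithms for lattice gauge theory;
figures of merit are autocorrelation/cost numbers at stated couplings and volumes; no
continuum-physics claim.

Venture `LatticeQCDFlow` (cell pub-lqcd), topic `Exactness`, FANOUT row 9 (eng-latcore; a leaf of the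
'update + over-relaxation' composite line — HOME/eng-latcore/lean-sources/gen21/README.md — the one hypothesis
`a • Haar|_V ≤ ν` that `MetropolisSweepExactStepErgodic.lean` / `ExactStepBoxMinorised.lean` ask of a step law, for
each of the engine's laws).  NEW WORK of the cell over the tree (`U1MetropolisLinkErgodic.u1KickLaw`,
`U1ExpChartMinorisation.smul_haarProbability_circle_eq_map_exp`; `SU2MetropolisKickLaw.smul_map_restrict_ball_le_su2MetropolisKick`,
`SU2MetropolisKickCovering` (`su2TraceBump`, `withDensity_su2TraceBump_le`); `SUNMetropolisKickLaw.exists_smul_chart_le_sunMetropolisKick`,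
`SUNExpChartMinorisation.exists_smul_haar_restrict_le_map_suExp`; `SUNMultiStepPositionLaw.chartKickR`) and Mathlib
(`Circle.exp_eq_exp`, `AddCircle.homeomorphCircle'`, `QuotientAddGroup.isOpenMap_coe`).  Nothing is cited as a fact;
no number is claimed.

* §1 `isOpenMap_circleExp`, `circleExp_preimage_image_ball`, **`exists_smul_haar_restrict_le_u1KickLaw`** (`u1_2d`).
* §2 `smul_restrict_le_withDensity_of_continuous`, **`exists_smul_haar_restrict_le_su2MetropolisKick`** (`SU(2)` Pauli kick).
* §3 **`exists_smul_haar_restrict_le_sunMetropolisKick`** (`SU(N)` exponential kick, every `N`).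
* §4 **`exists_smul_haar_restrict_le_chartKickR`** (the HMC chart kick of radius `r > 0`).

NOT CLAIMED: any value of the constants (inverse function theorem, compactness).
-/

noncomputable section

namespace Summit.Ventures.LatticeQCDFlow.Exactness

open MeasureTheory Measure Metric Set Filter Topology Function ProbabilityTheory ProbabilityTheory.Kernel
open Literature.MathematicalPhysics.QuantumFieldTheory
open Literature.MathematicalPhysics.QuantumFieldTheory.Balaban1983to89.B10Eq18SigmaSU2Haar (expPauli)
open scoped ENNReal Matrix

/-! ## §1 The `U(1)` kick law dominates Haar near the identity -/

section U1Kick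

/-- `θ ↦ e^{iθ}` is an open map (a homeomorphism of `ℝ/2πℤ` with the circle after the open quotient map). -/
theorem isOpenMap_circleExp : IsOpenMap (Circle.exp : ℝ → Circle) := by
  have h : (Circle.exp : ℝ → Circle) =
      (AddCircle.homeomorphCircle' : AddCircle (2 * Real.pi) → Circle) ∘ (QuotientAddGroup.mk : ℝ → AddCircle (2 * Real.pi)) := by
    funext θ
    exact (AddCircle.homeomorphCircle'_apply_mk θ).symm
  rw [h]
  exact AddCircle.homeomorphCircle'.isOpenMap.comp (QuotientAddGroup.isOpenMap_coe)

/-- **One period**: for `0 < s₁ ≤ π`, `exp⁻¹(exp(B(0, s₁))) ∩ B(0, π) = B(0, s₁)`. -/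
theorem circleExp_preimage_image_ball {s₁ : ℝ} (hs₁ : s₁ ≤ Real.pi) :
    Circle.exp ⁻¹' (Circle.exp '' ball (0 : ℝ) s₁) ∩ ball (0 : ℝ) Real.pi = ball (0 : ℝ) s₁ := by
  ext θ
  simp only [mem_inter_iff, mem_preimage, mem_image, mem_ball, dist_zero_right, Real.norm_eq_abs]
  constructor
  · rintro ⟨⟨θ', hθ', hexp⟩, hθ⟩
    obtain ⟨m, hm⟩ := Circle.exp_eq_exp.1 hexp.symm
    -- `θ = θ' + m·2π` with `|θ| < π`, `|θ'| < s₁ ≤ π` forces `m = 0`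
    have h1 : (m : ℝ) * (2 * Real.pi) = θ - θ' := by rw [hm]; ring
    have hlt : |(m : ℝ)| * (2 * Real.pi) < 1 * (2 * Real.pi) := by
      calc |(m : ℝ)| * (2 * Real.pi) = |(m : ℝ) * (2 * Real.pi)| := by
            rw [abs_mul, abs_of_pos Real.two_pi_pos]
        _ = |θ - θ'| := by rw [h1]
        _ ≤ |θ| + |θ'| := abs_sub _ _
        _ < Real.pi + s₁ := add_lt_add hθ hθ'
        _ ≤ 1 * (2 * Real.pi) := by linarith
    have hmR : |(m : ℝ)| < 1 := lt_of_mul_lt_mul_right hlt Real.two_pi_pos.le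
    have hm0 : m = 0 := Int.abs_lt_one_iff.1 (by exact_mod_cast hmR)
    rw [hm0, Int.cast_zero, zero_mul, add_zero] at hm
    rw [hm]
    exact hθ'
  · intro hθ
    exact ⟨⟨θ, hθ, rfl⟩, hθ.trans_le hs₁⟩

/-- **THE ENGINE'S `U(1)` KICK LAW DOMINATES HAAR NEAR THE IDENTITY**: for every `s > 0` there are an open
`V ∋ 1` and `a ≠ 0` with `a • Haar|_V ≤ u1KickLaw s` (`V = exp(B(0, min s π))`, `a = 2π/2s`). -/
theorem exists_smul_haar_restrict_le_u1KickLaw {s : ℝ} (hs : 0 < s) :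
    ∃ V : Set Circle, IsOpen V ∧ (1 : Circle) ∈ V ∧ ∃ a : ℝ≥0∞, a ≠ 0 ∧
      a • (haarProbability Circle).restrict V ≤ u1KickLaw s := by
  set s₁ : ℝ := min s Real.pi with hs₁
  have hs₁0 : 0 < s₁ := lt_min hs Real.pi_pos
  have hs₁π : s₁ ≤ Real.pi := min_le_right _ _
  have hs₁s : s₁ ≤ s := min_le_left _ _
  set V : Set Circle := Circle.exp '' ball (0 : ℝ) s₁ with hV
  have hVo : IsOpen V := isOpenMap_circleExp _ isOpen_ball
  have hexpm : Measurable (Circle.exp : ℝ → Circle) := Circle.exp.continuous.measurable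
  have h2s : ENNReal.ofReal (2 * s) ≠ 0 := by rw [Ne, ENNReal.ofReal_eq_zero, not_le]; positivity
  refine ⟨V, hVo, ⟨0, mem_ball_self hs₁0, Circle.exp_zero⟩, (ENNReal.ofReal (2 * s))⁻¹ * ENNReal.ofReal (2 * Real.pi),
    mul_ne_zero (ENNReal.inv_ne_zero.2 ENNReal.ofReal_ne_top)
      (by rw [Ne, ENNReal.ofReal_eq_zero, not_le]; positivity), ?_⟩
  refine Measure.le_iff.2 fun A hA => ?_
  rw [Measure.smul_apply, Measure.restrict_apply hA, smul_eq_mul, u1KickLaw, Measure.map_apply hexpm hA,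
    Measure.smul_apply, Measure.restrict_apply (hexpm hA), smul_eq_mul]
  -- `2π · Haar(A ∩ V) = Leb(exp⁻¹(A ∩ V) ∩ B(0, π)) = Leb(exp⁻¹ A ∩ B(0, s₁))`
  have hHaar : ENNReal.ofReal (2 * Real.pi) * haarProbability Circle (A ∩ V) =
      volume (Circle.exp ⁻¹' A ∩ ball (0 : ℝ) s₁) := by
    have h := congrArg (fun μ : Measure Circle => μ (A ∩ V)) smul_haarProbability_circle_eq_map_exp
    simp only [Measure.smul_apply, smul_eq_mul] at h
    rw [h, Measure.map_apply hexpm (hA.inter hVo.measurableSet), Measure.restrict_apply (hexpm (hA.inter hVo.measurableSet)),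
      preimage_inter, inter_assoc, circleExp_preimage_image_ball hs₁π]
  calc (ENNReal.ofReal (2 * s))⁻¹ * ENNReal.ofReal (2 * Real.pi) * haarProbability Circle (A ∩ V)
      = (ENNReal.ofReal (2 * s))⁻¹ * volume (Circle.exp ⁻¹' A ∩ ball (0 : ℝ) s₁) := by rw [mul_assoc, hHaar]
    _ ≤ (ENNReal.ofReal (2 * s))⁻¹ * volume (Circle.exp ⁻¹' A ∩ ball (0 : ℝ) s) :=
        mul_le_mul' le_rfl (measure_mono (inter_subset_inter_right _ (ball_subset_ball hs₁s)))

end U1Kick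

/-! ## §2 The `SU(2)` Pauli kick law dominates Haar near the identity -/

section SU2Kick

/-- **A continuous density positive at `1` dominates a multiple of the reference measure near `1`**:
`(φ(1)/2) • μ|_{ {φ > φ(1)/2} } ≤ φ · μ`. -/
theorem smul_restrict_le_withDensity_of_continuous {G : Type*} [TopologicalSpace G] [MeasurableSpace G]
    [OpensMeasurableSpace G] [One G] (μ : Measure G) {φ : G → ℝ} (hφ : Continuous φ) :
    ENNReal.ofReal (φ 1 / 2) • μ.restrict {x | φ 1 / 2 < φ x} ≤ μ.withDensity fun x => ENNReal.ofReal (φ x) := by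
  have hO : MeasurableSet {x | φ 1 / 2 < φ x} := (isOpen_lt continuous_const hφ).measurableSet
  refine Measure.le_iff.2 fun A hA => ?_
  rw [Measure.smul_apply, Measure.restrict_apply hA, smul_eq_mul, withDensity_apply _ hA]
  calc ENNReal.ofReal (φ 1 / 2) * μ (A ∩ {x | φ 1 / 2 < φ x})
      = ∫⁻ _ in A ∩ {x | φ 1 / 2 < φ x}, ENNReal.ofReal (φ 1 / 2) ∂μ := (MeasureTheory.setLIntegral_const _ _).symm
    _ ≤ ∫⁻ x in A ∩ {x | φ 1 / 2 < φ x}, ENNReal.ofReal (φ x) ∂μ :=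
        setLIntegral_mono' (hA.inter hO) fun x hx => ENNReal.ofReal_le_ofReal hx.2.le
    _ ≤ ∫⁻ x in A, ENNReal.ofReal (φ x) ∂μ := lintegral_mono' (Measure.restrict_mono inter_subset_left le_rfl) le_rfl

variable {s : ℝ} [Fact (0 < s)]

/-- **THE ENGINE'S `SU(2)` PAULI KICK LAW DOMINATES HAAR NEAR THE IDENTITY**: there are an open `V ∋ 1` and
`a ≠ 0` with `a • Haar|_V ≤ su2MetropolisKick s` (through the trace bump of `SU2MetropolisKickCovering`). -/
theorem exists_smul_haar_restrict_le_su2MetropolisKick :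
    ∃ V : Set (Matrix.specialUnitaryGroup (Fin 2) ℂ), IsOpen V ∧ (1 : Matrix.specialUnitaryGroup (Fin 2) ℂ) ∈ V ∧
      ∃ a : ℝ≥0∞, a ≠ 0 ∧ a • (haarProbability (Matrix.specialUnitaryGroup (Fin 2) ℂ)).restrict V ≤ su2MetropolisKick s := by
  have hs0 : 0 < s := Fact.out
  obtain ⟨hr0, hrπ⟩ := su2KickRadius_pos hs0
  set r := su2KickRadius s with hr
  set C : ℝ≥0∞ := ENNReal.ofReal (4 * (2 * Real.pi ^ 2)⁻¹) with hC
  have hC0 : C ≠ 0 := by rw [hC, Ne, ENNReal.ofReal_eq_zero, not_le]; positivity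
  have hCtop : C ≠ ⊤ := ENNReal.ofReal_ne_top
  set φ : Matrix.specialUnitaryGroup (Fin 2) ℂ → ℝ := su2TraceBump r with hφ
  have hφ1 : 0 < φ 1 := su2TraceBump_one_pos hr0 hrπ
  refine ⟨{x | φ 1 / 2 < φ x}, isOpen_lt continuous_const (continuous_su2TraceBump r), by
    show φ 1 / 2 < φ 1; linarith, su2KickConst s * C⁻¹ * ENNReal.ofReal (φ 1 / 2),
    mul_ne_zero (mul_ne_zero (su2KickConst_ne_zero hs0) (ENNReal.inv_ne_zero.2 hCtop))
      (by rw [Ne, ENNReal.ofReal_eq_zero, not_le]; linarith), ?_⟩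
  -- `(φ(1)/2) • Haar|_V ≤ φ · Haar ≤ C • chart measure ≤ C/κ • kick`
  have h1 := smul_restrict_le_withDensity_of_continuous (haarProbability (Matrix.specialUnitaryGroup (Fin 2) ℂ))
    (continuous_su2TraceBump r)
  have h2 := withDensity_su2TraceBump_le (r := r) hr0
  have h3 := smul_map_restrict_ball_le_su2MetropolisKick (s := s)
  refine Measure.le_iff'.2 fun A => ?_
  have e1 := Measure.le_iff'.1 h1 A
  have e2 := Measure.le_iff'.1 h2 A
  have e3 := Measure.le_iff'.1 h3 A
  simp only [Measure.smul_apply, smul_eq_mul] at e1 e2 e3 ⊢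
  calc su2KickConst s * C⁻¹ * ENNReal.ofReal (φ 1 / 2) *
        (haarProbability (Matrix.specialUnitaryGroup (Fin 2) ℂ)).restrict {x | φ 1 / 2 < φ x} A
      = su2KickConst s * C⁻¹ * (ENNReal.ofReal (φ 1 / 2) *
          (haarProbability (Matrix.specialUnitaryGroup (Fin 2) ℂ)).restrict {x | φ 1 / 2 < φ x} A) := by ring
    _ ≤ su2KickConst s * C⁻¹ * (C * ((volume.restrict (ball (0 : EuclideanSpace ℝ (Fin 3)) r)).map expPauli) A) :=
        mul_le_mul' le_rfl (e1.trans e2)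
    _ = su2KickConst s * ((volume.restrict (ball (0 : EuclideanSpace ℝ (Fin 3)) r)).map expPauli) A := by
        rw [← mul_assoc, mul_assoc (su2KickConst s), ENNReal.inv_mul_cancel hC0 hCtop, mul_one]
    _ ≤ su2MetropolisKick s A := e3

end SU2Kick

/-! ## §3 The `SU(N)` exponential kick law -/

section SUNKick

variable (N : ℕ) (s : ℝ) [Fact (0 < s)]

/-- **The engine's `SU(N)` kick law dominates Haar near the identity**: `a • Haar|_V ≤ sunMetropolisKick N s`
for some `V ∈ 𝓝 1` and `a ≠ 0`. -/
theorem exists_smul_haar_restrict_le_sunMetropolisKick :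
    ∃ V ∈ 𝓝 (1 : Matrix.specialUnitaryGroup (Fin N) ℂ), ∃ a : ℝ≥0∞, a ≠ 0 ∧
      a • (haarProbability (Matrix.specialUnitaryGroup (Fin N) ℂ)).restrict V ≤ sunMetropolisKick N s := by
  obtain ⟨W, hW, c, hc, hle⟩ := exists_smul_chart_le_sunMetropolisKick N s
  obtain ⟨V, hV, c', hc', hle'⟩ := exists_smul_haar_restrict_le_map_suExp (sunCoordι N) (sunCoordι_skew N)
    (sunCoordι_injective N) (sunCoordι_range N) Measure.addHaar hW
  refine ⟨V, hV, c * c', mul_ne_zero hc hc', ?_⟩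
  calc (c * c') • (haarProbability (Matrix.specialUnitaryGroup (Fin N) ℂ)).restrict V
      = c • (c' • (haarProbability (Matrix.specialUnitaryGroup (Fin N) ℂ)).restrict V) := by rw [mul_smul]
    _ ≤ c • ((Measure.addHaar : Measure (SUNCoords N)).restrict W).map (sunExp N) := by
        refine Measure.le_iff'.2 fun A => ?_
        simp only [Measure.smul_apply, smul_eq_mul]
        exact mul_le_mul' le_rfl (Measure.le_iff'.1 hle' A)
    _ ≤ sunMetropolisKick N s := hle

end SUNKick

/-! ## §4 The HMC chart kick of radius `r` -/

section Chart

variable {n : Type*} [Fintype n] [DecidableEq n]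
variable {E : Type*} [NormedAddCommGroup E] [NormedSpace ℝ E] [MeasurableSpace E] [BorelSpace E]
  [FiniteDimensional ℝ E]
variable (ι : E →ₗ[ℝ] Matrix n n ℂ) (hι : ∀ a, (ι a)ᴴ = -ι a ∧ (ι a).trace = 0)
  (μ : Measure E) [μ.IsAddHaarMeasure]

/-- **The chart kick of radius `r > 0` dominates Haar near the identity**: `a • Haar|_V ≤ chartKickR r` for some
`V ∈ 𝓝 1` and `a ≠ 0`. -/
theorem exists_smul_haar_restrict_le_chartKickR (hinj : Injective ι)
    (hsurj : ∀ X : Matrix n n ℂ, Xᴴ = -X → X.trace = 0 → X ∈ LinearMap.range ι) {r : ℝ} (hr : 0 < r) :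
    ∃ V ∈ 𝓝 (1 : Matrix.specialUnitaryGroup n ℂ), ∃ a : ℝ≥0∞, a ≠ 0 ∧
      a • (haarProbability (Matrix.specialUnitaryGroup n ℂ)).restrict V ≤ chartKickR ι hι μ r := by
  obtain ⟨V, hV, c, hc, hle⟩ := exists_smul_haar_restrict_le_map_suExp ι hι hinj hsurj μ (ball_mem_nhds (0 : E) hr)
  have hB0 : μ (ball (0 : E) r) ≠ 0 := (measure_ball_pos μ _ hr).ne'
  have hBtop : μ (ball (0 : E) r) ≠ ⊤ := measure_ball_lt_top.ne
  refine ⟨V, hV, (μ (ball (0 : E) r))⁻¹ * c, mul_ne_zero (ENNReal.inv_ne_zero.2 hBtop) hc, ?_⟩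
  rw [mul_smul]
  calc (μ (ball (0 : E) r))⁻¹ • (c • (haarProbability (Matrix.specialUnitaryGroup n ℂ)).restrict V)
      ≤ (μ (ball (0 : E) r))⁻¹ • (μ.restrict (ball (0 : E) r)).map (suExp ι hι) := by
        refine Measure.le_iff'.2 fun A => ?_
        simp only [Measure.smul_apply, smul_eq_mul]
        exact mul_le_mul' le_rfl (Measure.le_iff'.1 hle A)
    _ = chartKickR ι hι μ r := by rw [chartKickR]

end Chart

end Summit.Ventures.LatticeQCDFlow.Exactness
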